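import Literature.AlgebraicGeometry.Motives.AbelianVarietyKummerPairingAnalytic
import Literature.AlgebraicGeometry.Motives.AbelianVarietyWeilPairingLevel
import HarnessLib

/-!
# D5: the algebraic level-`N` Weil pairing of a complex abelian variety read on its uniformising torus —
# `ē_N^Θ(φ s, φ w) = q⁽ᴺ⁾(s, φ_H w)⁻¹ = e(−2πi N·E(w̃, s̃)) = e(2πi N·E(s̃, w̃))`

Layer `Literature/AlgebraicGeometry/Motives`, namespace `Literature.AlgebraicGeometry.Motives.AbelianVariety`.  PROOF FILE
(theorems only; no definition, no named fact).  The «analytic ↔ algebraic Weil-pairing bridge» (cell hodgecm-mathlib,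
M1PRIME-DAG §5 D5 / U-DAG D5, census `B-provers/B-p03/CENSUS-D5…` §4) for a complex abelian variety `A` uniformised by
`φ : X = V/Λ → A(ℂ)` (the J′ variable block): the ALGEBRAIC level-`N` Weil pairing of a Cartier divisor `Θ`,
`ē_N^Θ(P, Q) = e_N(P, t_Q^*Θ − Θ)` (`AbelianVariety.weilPairingLevel`, Lang VII §2 / Milne §16 / Mumford §20), evaluated at
`P = φ s`, `Q = φ w`, equals the inverse of Lange's ANALYTIC torsion pairing `q⁽ᴺ⁾(s, φ_H w)` (`ComplexTorus.torsionPairing`,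
§2.7.4 Exercise (3)) where `H` is the Néron–Severi form of `[𝒪(Θ)^an]` (an Appell–Humbert datum `p` with `⟦a_p⟧ = [𝒪(Θ)^an]`,
`φ_H = phiH Φ (intGram Φ p.form)`), hence the exponential of the first Chern class:

  `ē_N^Θ(φ s, φ w) = e(2πi · N · E(s̃, w̃))`,  `E = p.form = Im H`.

Assembly of ★ `kummerConst_eq_torsionPairing_inv` (the junction (J)), ★ `picClass_cartierDivisorLineBundle_weilDiv`
(`[𝒪(t_{φ t̄}^*Θ − Θ)^an] = φ_L(t̄)`), ★ `AHData.phiL_toPic_eq_dualToPic_phiH` (Lemma 1.4.5: `φ_L = dualToPic ∘ φ_H`) and ★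
`torsionPairing_proj_phiH_proj_of_zsmul_phiH_eq_zero` (the formula `q⁽ᵐ⁾(π v, φ_H π w) = e(2πi m E(w, v))`).

* `weilPairingLevel_eq_torsionPairing_inv` — `ē_N^Θ(φ s, φ w) = q⁽ᴺ⁾(s, φ_H w)⁻¹`;
* `weilPairingLevel_eq_cexp` — `ē_N^Θ(φ(π v), φ(π u)) = e(2πi N E(Φ v, Φ u))` in lattice coordinates (`v, u ∈ ℝ^ι`,
  `π v, π u` `N`-torsion).

## References
* [Lang1983AbelianVarieties] S. Lang, *Abelian Varieties*, Ch. VII §2 (the pairing `e_N`).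
* [Milne1986AbelianVarieties] J. S. Milne, *Abelian varieties* (1986), §16 (pp. 127, 132: `ē_m^λ`, `e^λ`, the Riemann form).
* [MumfordAV1970] D. Mumford, *Abelian Varieties* (1970), §20 (Riemann form of `L` = `e^L`), §24.
* [Lange2023AbelianVarietiesComplex] H. Lange, *Abelian Varieties over the Complex Numbers* (2023), §2.7.1 (2.13), Lemma 2.7.1,
  §2.7.4 Exercise (3), §1.4.2 Lemma 1.4.5.
-/

noncomputable section

open CategoryTheory AlgebraicGeometry TopologicalSpace Set Function Filter Complex
open scoped Manifold Topology Real
open Literature.Geometry.Kaehler Literature.Geometry.Kaehler.ComplexTorus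
open Literature.NumberTheory.Transcendental Literature.AlgebraicGeometry.HodgeTheory

namespace Literature.AlgebraicGeometry.Motives.AbelianVariety

open RatFn AlgPoints

section WeilAnalytic

variable {A : AbelianVariety ℂ} {ι : Type} [Fintype ι] [DecidableEq ι] {Φ : (ι → ℝ) ≃L[ℝ] (Fin A.dim → ℂ)}
  {φ : ComplexTorus Φ → ComplexPoints A.X} (hφ : IsAnalytification (Fin A.dim → ℂ) A.X A.dim φ)
  (hadd : ∀ x y, φ (x + y) = φ x * φ y)

include hadd in
omit [Fintype ι] [DecidableEq ι] in
/-- `N s = 0` in the torus for an `N`-torsion point `φ s` of `A`. [cite: Lange2023AbelianVarietiesComplex, §1.1] -/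
private theorem nsmul_eq_zero_of_pow_eq_one (hinj : Function.Injective φ) {N : ℕ} {s : ComplexTorus Φ}
    (hs : φ s ^ N = 1) : N • s = 0 := by
  apply hinj
  have h0 : φ 0 = 1 := by
    have h := hadd 0 0
    rw [add_zero] at h
    exact mul_eq_left.mp h.symm
  have hN : ∀ k : ℕ, φ (k • s) = φ s ^ k := by
    intro k
    induction k with
    | zero => rw [zero_smul, pow_zero, h0]
    | succ k ih => rw [succ_nsmul, hadd, ih, pow_succ]
  rw [hN, hs, h0]

include hφ hadd in
/-- **D5, pairing form: `ē_N^Θ(φ s, φ w) = q⁽ᴺ⁾(s, φ_H w)⁻¹`.**  For a Cartier divisor `Θ` on `A`, an Appell–Humbert datum `p`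
with `⟦a_p⟧ = [𝒪(Θ)^an]` in `Pic(X)`, and `N`-torsion points `P = φ s`, `Q = φ w`: the algebraic level-`N` Weil pairing is
the inverse of Lange's torsion pairing of `s` with `φ_H(w)`, `φ_H = phiH Φ (intGram Φ p.form)` (Lemma 1.4.5).
[cite: Lang1983AbelianVarieties, Ch. VII §2] [cite: Lange2023AbelianVarietiesComplex, §2.7.4 Exercise (3) and §1.4.2 Lemma 1.4.5]
[cite: Milne1986AbelianVarieties, §16 (p. 132)] -/
theorem weilPairingLevel_eq_torsionPairing_inv {N : ℕ} [IsDominant (Hom.toSchemeHom ((N : ℤ) • 𝟙 A))]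
    (Θ : CartierDivisor A.X.left) (p : AHData Φ) (hp : AHData.toPic p = picClass (cartierDivisorLineBundle hφ Θ))
    (s w : ComplexTorus Φ) (P Q : A.torsionPoints ℂ N) (hP : (P : A.Points ℂ) = φ s) (hQ : (Q : A.Points ℂ) = φ w) :
    A.weilPairingLevel Θ P Q = (torsionPairing Φ (N : ℤ) s (phiH Φ (intGram Φ p.form) w))⁻¹ := by
  have hGmap : (intGram Φ p.form).map (Int.cast : ℤ → ℝ) = latticeGram Φ p.form := map_intGram Φ p.isNSForm_form
  have ht : ((dualEquivPicZero Φ (Multiplicative.ofAdd (phiH Φ (intGram Φ p.form) w)) : picZero Φ) : Pic Φ) =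
      picClass (cartierDivisorLineBundle hφ (A.weilDiv Θ (Q : A.Points ℂ))) := by
    rw [coe_dualEquivPicZero_apply, hQ, picClass_cartierDivisorLineBundle_weilDiv A hφ hadd, ← hp,
      AHData.phiL_toPic_eq_dualToPic_phiH p hGmap w]
    rfl
  rw [weilPairingLevel]
  exact kummerConst_eq_torsionPairing_inv hφ hadd (A.weilDiv Θ (Q : A.Points ℂ)) (A.isTrivializer_weilFn Θ Q)
    _ ht s P hP

include hφ hadd in
/-- **D5, exponential form: `ē_N^Θ(φ(π v), φ(π u)) = e(2πi · N · E(Φ v, Φ u))`** in lattice coordinates (`π : ℝ^ι → X`,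
`Φ : ℝ^ι ≃ V`), `E = p.form` the Néron–Severi (first Chern class) form of `[𝒪(Θ)^an]`: the algebraic Weil pairing IS
`e(2πi N E)` — Lange (2.13) «`ε^L(v̄, w̄) = e(−2πi Im H(v, w))`» / Milne §16 «the Riemann form of `λ`», through the junction.
[cite: Lange2023AbelianVarietiesComplex, §2.7.1 (2.13) and §2.7.4 Exercise (3)] [cite: Milne1986AbelianVarieties, §16 (pp. 127, 132)]
[cite: MumfordAV1970, §20 (p. 183) and §24] -/
theorem weilPairingLevel_eq_cexp {N : ℕ} [IsDominant (Hom.toSchemeHom ((N : ℤ) • 𝟙 A))]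
    (Θ : CartierDivisor A.X.left) (p : AHData Φ) (hp : AHData.toPic p = picClass (cartierDivisorLineBundle hφ Θ))
    (v u : ι → ℝ) (P Q : A.torsionPoints ℂ N) (hP : (P : A.Points ℂ) = φ (proj Φ v))
    (hQ : (Q : A.Points ℂ) = φ (proj Φ u)) :
    (A.weilPairingLevel Θ P Q : ℂ) = cexp (2 * π * I * (((N : ℝ) * p.form ![Φ v, Φ u] : ℝ) : ℂ)) := by
  have hGmap : (intGram Φ p.form).map (Int.cast : ℤ → ℝ) = latticeGram Φ p.form := map_intGram Φ p.isNSForm_form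
  have hinj : Function.Injective φ := hφ.isHomeomorph.injective
  have hs : N • proj Φ v = 0 :=
    nsmul_eq_zero_of_pow_eq_one hadd hinj (by rw [← hP]; exact coe_torsionPoints_pow_eq_one P)
  have hw : N • proj Φ u = 0 :=
    nsmul_eq_zero_of_pow_eq_one hadd hinj (by rw [← hQ]; exact coe_torsionPoints_pow_eq_one Q)
  have hs' : (N : ℤ) • proj Φ v = 0 := by rw [natCast_zsmul]; exact hs
  have hw' : (N : ℤ) • phiH Φ (intGram Φ p.form) (proj Φ u) = 0 := by
    rw [natCast_zsmul, phiH_eq, ← mapMatrixHom_apply, ← map_nsmul, mapMatrixHom_apply, ← phiH_eq, hw, phiH_eq,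
      ← mapMatrixHom_apply, map_zero]
  rw [weilPairingLevel_eq_torsionPairing_inv hφ hadd Θ p hp (proj Φ v) (proj Φ u) P Q hP hQ,
    torsionPairing_proj_phiH_proj_of_zsmul_phiH_eq_zero Φ p.form hGmap (N : ℤ) hs' hw', ← Complex.exp_neg]
  congr 1
  have halt : p.form ![Φ u, Φ v] = -p.form ![Φ v, Φ u] := by
    have h := p.form.toAlternatingMap.map_swap ![Φ v, Φ u] (show (0 : Fin 2) ≠ 1 by decide)
    have e : (![Φ v, Φ u] ∘ Equiv.swap (0 : Fin 2) 1) = ![Φ u, Φ v] := by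
      funext i; fin_cases i <;> rfl
    rw [e] at h
    exact h
  rw [Int.cast_natCast, halt]
  push_cast
  ring

end WeilAnalytic

end Literature.AlgebraicGeometry.Motives.AbelianVariety

end
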